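import Summits.ResolutionOfSingularities.ResolutionOfSingularities.Theorems.HomologicalConductorNoZenoSelfIntersectionStrict
import Summits.ResolutionOfSingularities.ResolutionOfSingularities.Theorems.HomologicalConductorNoZenoDuValMatrixForm
import HarnessLib

/-!
# Crux `NoZenoR` (stmt-ResolutionOfSingularities-19943), facts slot `Lipman1969_14_1`: du Val's lemma for a FINITE
# FAMILY of exceptional curves — negative definiteness of `((E_i·E_j))` modulo the symmetry `(E_i·E_j) = (E_j·E_i)`

Route `ResolutionOfSingularities/HomologicalConductor` (cell decomp-res, hand leafhand-res-homologicalconduct-9 g0).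
OURS: AI-written bookkeeping, weaker than expert review; nothing here is a statement of the manuscript under review
(Hironaka 2017).  SUPPORT level, counted 0.  Def-free, FACT-FREE (the only Lipman statement used, (13.1) c), is the tree
THEOREM `Lipman1969_13_1_c_holds`).

Generalises `…NoZenoSelfIntersectionStrict` (p811993, one curve) to the binder shape of the typed named fact
`Lipman1969_14_1` (Lipman 1969, Lemma (14.1): "The intersection matrix `((E_i·E_j))` is negative-definite"; du Val,
Mumford): for a desingularization `π : X → Spec S` of a two-dimensional normal Noetherian local domain, a finite family
`F ⊆ excCurvePoints π` and `y : F → ℤ`, `y ≠ 0`, one has `Σ_i Σ_j y_i y_j (E_j·E_i) < 0` — HERE under the explicit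
hypothesis that `(E_j·E_i) = (E_i·E_j)` for `i ≠ j` in `F` (the symmetric form "`= (E·F)`" of Lipman's (13.1) d); in the
tree it is available in the rational regime through `Lipman1969_13_1_d_rat`, and unconditionally it is the local
identity `ℓ(𝒪_{X,x}/(t_i,t_j))` of Fulton, Thm. 2.4 Case 1 — not proved in this file).

The geometric half (this file).  With `0 ≠ f ∈ 𝔪_S`, `P = div(π^*f)` (effective, `(P·E_i) = 0`), `a_j = ord_{η_j} P ≥ 1`,
`e_j = ord_{η_j}[E_j] ≥ 1`, `e = Π_j e_j`, `b_j = a_j Π_{k ≠ j} e_k ≥ 1`: for EVERY sub-family `C ⊆ F` the divisor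
`D'_C = e·P − Σ_{j ∈ C} b_j [E_j]` is effective and avoids the `η_i`, `i ∈ C` (orders at codimension-one points, `X`
regular), `e·P ∼ D'_C + Σ_{j∈C} b_j [E_j]`, hence `Σ_{j ∈ C} b_j (E_j·E_i) = −(D'_C·E_i) ≤ 0` for `i ∈ C`
(`row_relation`).  If these vanished for all `i` of a NON-EMPTY `C`, (13.1) c) would make `D'_C` avoid every point of
every `E_i`, `i ∈ C`; then (A) off `⋃_{i∈C} E_i`, avoidance by `D'_C` makes `f` a unit; (B) by Zariski connectedness
of the closed fibre (`IsResolution.isPreconnected_closedFibre`) the closed fibre lies in `⋃_{i ∈ C} E_i`; (C) by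
Krull's principal ideal theorem a prime `𝔭 ∋ f` of height `≤ 1` carries a point of `X` specialising into the closed
fibre, where `D'_C` avoids — so `f ∉ 𝔭`, absurd (`exists_restricted_rowSum_ne_zero`).  The matrix half is
`quadForm_neg_of_symm_of_rowSum_nonpos_int` (p812394).

* `lipman1969_14_1_of_comm` — Lemma (14.1) for finite families, modulo the symmetry hypothesis (universe `0`).

References: J. Lipman, Publ. Math. IHÉS 36 (1969), Lemma (14.1) p. 224, Prop. (13.1) c) p. 223 [`Lipman1969`];
D. Mumford, Publ. Math. IHÉS 9 (1961), p. 6.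
-/

noncomputable section

-- single-problem summit: the doubled namespace component `ResolutionOfSingularities` is forced
set_option linter.dupNamespace false

namespace Summit.ResolutionOfSingularities.ResolutionOfSingularities.Theorems.NoZeno.ExcCount

open CategoryTheory AlgebraicGeometry TopologicalSpace IsLocalRing Order
open Literature.AlgebraicGeometry.Resolution Literature.AlgebraicGeometry.Motives
open Literature.AlgebraicGeometry.Motives.RatFn

/-- **Lipman (14.1) for a finite family of exceptional curves, modulo symmetry — FACT-FREE otherwise.**  For a
desingularization `π : X → Spec S` of a two-dimensional normal Noetherian local domain, a finite set `F` of generic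
points of integral exceptional curves with their prime divisors `[E_η]`, assuming `(E_j·E_i) = (E_i·E_j)` for `i ≠ j`
in `F`: for every non-zero `y : F → ℤ`, `Σ_i Σ_j y_i y_j (E_j·E_i) < 0` (the binder shape of `Lipman1969_14_1`,
universe `0`).  Proof in the module docstring. [cite: Lipman1969, Lemma (14.1) (p. 224)] -/
theorem lipman1969_14_1_of_comm {S : Type} [CommRing S] [IsNoetherianRing S] [IsLocalRing S] [IsDomain S]
    [IsIntegrallyClosed S] (h2 : ringKrullDim S = 2) {X : Scheme.{0}} [IsIntegral X] [IsLocallyNoetherian X]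
    {π : X ⟶ Spec (.of S)} (hπ : IsResolution π) (F : Finset X) (hF : ∀ η ∈ F, η ∈ excCurvePoints π)
    (hc : ∀ η ∈ F, IsEffectiveCartier (primeDivisorIdeal η))
    (hcomm : ∀ i j : {η // η ∈ F}, (i : X) ≠ j →
      excCurveDegree π (CartierDivisor.ofIsEffectiveCartier (primeDivisorIdeal (j : X)) (hc j j.2)) i =
        excCurveDegree π (CartierDivisor.ofIsEffectiveCartier (primeDivisorIdeal (i : X)) (hc i i.2)) j)
    (y : {η // η ∈ F} → ℤ) (hy : y ≠ 0) :
    ∑ i, ∑ j, y i * y j *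
      excCurveDegree π (CartierDivisor.ofIsEffectiveCartier (primeDivisorIdeal (j : X)) (hc j j.2)) i < 0 := by
  classical
  haveI : IsProper π := hπ.isProper
  have hX : Scheme.IsRegular X := hπ.isRegular
  -- the prime divisors `E_j`, the matrix `M j i = (E_j · E_i)`
  set E : {η // η ∈ F} → CartierDivisor X := fun j =>
    CartierDivisor.ofIsEffectiveCartier (primeDivisorIdeal (j : X)) (hc j j.2) with hEdef
  show ∑ i, ∑ j, y i * y j * excCurveDegree π (E j) i < 0
  have hη : ∀ i : {η // η ∈ F}, (i : X) ∈ excCurvePoints π := fun i => hF i i.2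
  have hco : ∀ i : {η // η ∈ F}, coheight (i : X) = 1 := fun i =>
    hπ.coheight_eq_one_of_mem_excCurvePoints h2 (hη i)
  -- a non-zero element of the maximal ideal (`S` is not a field: `dim S = 2`)
  have hm : maximalIdeal S ≠ ⊥ := by
    intro h
    have h0 := ringKrullDim_eq_zero_of_isField (IsLocalRing.isField_iff_maximalIdeal_eq.mpr h)
    rw [h2] at h0
    exact absurd h0 (by decide)
  obtain ⟨f, hfm, hf0⟩ := Submodule.exists_mem_ne_zero_of_ne_bot hm
  -- the principal divisor `P = div(π^* f)`
  have hφ0 : baseToFunctionField π f ≠ 0 := fun h =>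
    hf0 (NoZeno.SandwichCluster.LemmaL.baseToFunctionField_injective π hπ (by rw [h, map_zero]))
  set P : CartierDivisor X := CartierDivisor.principal (baseToFunctionField π f) hφ0 with hPdef
  have hPeff : P.IsEffective := fun _ y _ => NoZeno.SandwichCluster.isRegularAt_baseToFunctionField π y f
  have hPη : ∀ i : {η // η ∈ F}, ¬ IsUnitAt (i : X) (P.f PUnit.unit) := by
    intro i
    change ¬ IsUnitAt (i : X) (baseToFunctionField π f)
    rw [isUnitAt_baseToFunctionField_iff, not_not, (hη i).1]
    exact hfm
  have ha : ∀ i : {η // η ∈ F}, 0 < P.ordAt i := fun i =>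
    hPeff.ordAt_pos (i := PUnit.unit) trivial (hPη i) (hco i)
  -- the prime divisors: effective, positive order at their own point, avoiding non-specialisations
  have hEeff : ∀ j, (E j).IsEffective := fun j => CartierDivisor.isEffective_ofIsEffectiveCartier _ (hc j j.2)
  have hEav : ∀ (j : {η // η ∈ F}) (z : X), ¬ (j : X) ⤳ z → (E j).Avoids z := fun j z hz =>
    (CartierDivisor.avoids_ofIsEffectiveCartier_iff _ (hc j j.2) z).2 (by rwa [mem_support_primeDivisorIdeal_iff])
  have hEη : ∀ j, ¬ (E j).Avoids j := fun j h =>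
    (CartierDivisor.avoids_ofIsEffectiveCartier_iff _ (hc j j.2) (j : X)).1 h
      ((mem_support_primeDivisorIdeal_iff (j : X) (j : X)).2 le_rfl)
  have he : ∀ j, 0 < (E j).ordAt j := by
    intro j
    have h := hEη j
    simp only [CartierDivisor.Avoids, not_forall] at h
    obtain ⟨i, hi, hu⟩ := h
    exact (hEeff j).ordAt_pos hi hu (hco j)
  -- distinct codimension-one points do not specialise to one another
  have hnsp : ∀ z w : X, coheight z = 1 → coheight w = 1 → z ≠ w → ¬ z ⤳ w := by
    intro z w hz hw hne hsp
    have hlt : w < z := ⟨Scheme.le_iff_specializes.2 hsp,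
      fun h' => hne (((Scheme.le_iff_specializes.1 h').antisymm hsp).eq).symm⟩
    have h1 := Order.coheight_add_one_le hlt
    rw [hz, hw] at h1
    exact absurd h1 (by decide)
  have hoff : ∀ (j : {η // η ∈ F}) (z : X), coheight z = 1 → z ≠ (j : X) → (E j).ordAt z = 0 :=
    fun j z hz hne =>
    (hEav j z (hnsp (j : X) z (hco j) hz (Ne.symm hne))).ordAt_eq_zero
  have hoff' : ∀ i j : {η // η ∈ F}, i ≠ j → (E j).ordAt i = 0 := fun i j hij =>
    hoff j i (hco i) fun h => hij (Subtype.ext h)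
  -- integer data: `a_j`, `e_j`, `e = Π e_j`, `b_j = a_j Π_{k ≠ j} e_k`
  set aN : {η // η ∈ F} → ℕ := fun j => (P.ordAt j).toNat with haN
  set eN : {η // η ∈ F} → ℕ := fun j => ((E j).ordAt j).toNat with heN
  have haZ : ∀ j, (aN j : ℤ) = P.ordAt j := fun j => Int.toNat_of_nonneg (ha j).le
  have heZ : ∀ j, (eN j : ℤ) = (E j).ordAt j := fun j => Int.toNat_of_nonneg (he j).le
  have haN0 : ∀ j, 0 < aN j := fun j => by
    have h := ha j; rw [← haZ j] at h; exact_mod_cast h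
  have heN0 : ∀ j, 0 < eN j := fun j => by
    have h := he j; rw [← heZ j] at h; exact_mod_cast h
  set e : ℕ := ∏ k, eN k with hedef
  set b : {η // η ∈ F} → ℕ := fun j => aN j * ∏ k ∈ Finset.univ.erase j, eN k with hbdef
  have he0 : 0 < e := Finset.prod_pos fun k _ => heN0 k
  have hb0 : ∀ j, 0 < b j := fun j => mul_pos (haN0 j) (Finset.prod_pos fun k _ => heN0 k)
  have hbe : ∀ j, (b j : ℤ) * (E j).ordAt j = e * P.ordAt j := by
    intro j
    rw [← heZ, ← haZ, hedef, hbdef, ← Finset.mul_prod_erase Finset.univ eN (Finset.mem_univ j)]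
    push_cast
    ring
  -- finite sums of divisors as iterated sums: orders, degrees, avoidance
  have hfold_ord : ∀ (l : List (CartierDivisor X)) (z : X),
      (l.foldr (· + ·) 0).ordAt z = (l.map fun D => D.ordAt z).sum := by
    intro l z
    induction l with
    | nil => simp [CartierDivisor.ordAt_zero]
    | cons D l ih => simp [List.foldr_cons, CartierDivisor.ordAt_add, ih]
  have hfold_deg : ∀ (l : List (CartierDivisor X)) (i : {η // η ∈ F}),
      excCurveDegree π (l.foldr (· + ·) 0) i = (l.map fun D => excCurveDegree π D i).sum := by
    intro l i
    induction l with
    | nil => simp [excCurveDegree_zero π (hη i)]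
    | cons D l ih => simp [List.foldr_cons, excCurveDegree_add π (hη i), ih]
  have hfold_av : ∀ (l : List (CartierDivisor X)) (z : X), (∀ D ∈ l, D.Avoids z) →
      (l.foldr (· + ·) 0).Avoids z := by
    intro l z
    induction l with
    | nil => exact fun _ => CartierDivisor.avoids_zero z
    | cons D l ih =>
      intro h
      simp only [List.foldr_cons]
      exact (h D (by simp)).add (ih fun D' hD' => h D' (by simp [hD']))
  -- the divisor `N_C = Σ_{j ∈ C} b_j [E_j]` of a sub-family `C`
  let N : Finset {η // η ∈ F} → CartierDivisor X := fun C =>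
    (C.toList.map fun j => b j • E j).foldr (· + ·) 0
  have hNord : ∀ C (z : X), (N C).ordAt z = ∑ j ∈ C, (b j : ℤ) * (E j).ordAt z := by
    intro C z
    simp only [N, hfold_ord, List.map_map]
    rw [← Finset.sum_map_toList C]
    congr 1
    refine List.map_congr_left fun j _ => ?_
    simp [CartierDivisor.ordAt_smul]
  have hNdeg : ∀ C (i : {η // η ∈ F}), excCurveDegree π (N C) i = ∑ j ∈ C, (b j : ℤ) * excCurveDegree π (E j) i := by
    intro C i
    simp only [N, hfold_deg, List.map_map]
    rw [← Finset.sum_map_toList C]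
    congr 1
    refine List.map_congr_left fun j _ => ?_
    simp [excCurveDegree_smul π (hη i)]
  have hNav : ∀ C (z : X), (∀ j : {η // η ∈ F}, j ∈ C → ¬ (j : X) ⤳ z) → (N C).Avoids z := by
    intro C z h
    refine hfold_av _ z fun D hD => ?_
    obtain ⟨j, hj, rfl⟩ := List.mem_map.1 hD
    exact (hEav j z (h j (Finset.mem_toList.1 hj))).smul (b j)
  -- `N_C` has order `b_i e_i = e a_i` at `η_i`, `i ∈ C`, and order `0` at every other codimension-one point
  have hNord_mem : ∀ C (i : {η // η ∈ F}), i ∈ C → (N C).ordAt i = e * P.ordAt i := by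
    intro C i hi
    rw [hNord, Finset.sum_eq_single_of_mem i hi fun j _ hji => by rw [hoff' i j (Ne.symm hji), mul_zero], hbe]
  have hNord_nmem : ∀ C (i : {η // η ∈ F}), i ∉ C → (N C).ordAt i = 0 := by
    intro C i hi
    rw [hNord]
    exact Finset.sum_eq_zero fun j hj => by
      rw [hoff' i j (fun h => hi (h ▸ hj)), mul_zero]
  have hNord_off : ∀ C (z : X), coheight z = 1 → (∀ j : {η // η ∈ F}, z ≠ (j : X)) → (N C).ordAt z = 0 := by
    intro C z hz hzF
    rw [hNord]
    exact Finset.sum_eq_zero fun j _ => by rw [hoff j z hz (hzF j), mul_zero]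
  -- `D'_C = e·P − N_C`: effective, avoiding `η_i` (`i ∈ C`), with `e·P ∼ D'_C + N_C`
  let D' : Finset {η // η ∈ F} → CartierDivisor X := fun C => e • P + -(N C)
  have hD'ord : ∀ C (z : X), (D' C).ordAt z = e * P.ordAt z - (N C).ordAt z := by
    intro C z
    simp only [D']
    rw [CartierDivisor.ordAt_add, CartierDivisor.ordAt_neg, CartierDivisor.ordAt_smul]
    ring
  have hD'mem : ∀ C (i : {η // η ∈ F}), i ∈ C → (D' C).ordAt i = 0 := by
    intro C i hi
    rw [hD'ord, hNord_mem C i hi, sub_self]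
  have hD'eff : ∀ C, (D' C).IsEffective := by
    intro C
    refine CartierDivisor.isEffective_of_forall_ordAt_nonneg hX fun z hz => ?_
    rw [hD'ord]
    by_cases hzF : ∃ j : {η // η ∈ F}, z = (j : X)
    · obtain ⟨j, rfl⟩ := hzF
      by_cases hj : j ∈ C
      · rw [hNord_mem C j hj, sub_self]
      · rw [hNord_nmem C j hj, sub_zero]
        exact mul_nonneg (Nat.cast_nonneg _) (hPeff.ordAt_nonneg _)
    · push Not at hzF
      rw [hNord_off C z hz hzF, sub_zero]
      exact mul_nonneg (Nat.cast_nonneg _) (hPeff.ordAt_nonneg _)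
  have hD'av : ∀ C (i : {η // η ∈ F}), i ∈ C → (D' C).Avoids i := fun C i hi =>
    (hD'eff C).avoids_of_ordAt_eq_zero (hco i) (hD'mem C i hi)
  have hsame : ∀ C, (e • P).SameDivisor (D' C + N C) := fun C =>
    CartierDivisor.sameDivisor_of_forall_ordAt_eq hX fun z _ => by
      rw [CartierDivisor.ordAt_add, hD'ord, CartierDivisor.ordAt_smul]
      ring
  -- the ROW RELATIONS: `Σ_{j ∈ C} b_j (E_j·E_i) = −(D'_C·E_i)` for `i ∈ F`
  have hrowC : ∀ C (i : {η // η ∈ F}),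
      ∑ j ∈ C, (b j : ℤ) * excCurveDegree π (E j) i = - excCurveDegree π (D' C) i := by
    intro C i
    have hdeg : (e : ℤ) * excCurveDegree π P i = excCurveDegree π (D' C) i + excCurveDegree π (N C) i := by
      rw [← excCurveDegree_smul π (hη i), excCurveDegree_congr_linEquiv π (hη i) (hsame C).linEquiv,
        excCurveDegree_add π (hη i)]
    rw [hPdef, excCurveDegree_principal π (hη i) hφ0, mul_zero, hNdeg] at hdeg
    linarith
  -- STRICTNESS on every non-empty sub-family (Zariski connectedness + Krull)
  have hstrict : ∀ C : Finset {η // η ∈ F}, C.Nonempty →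
      ∃ i ∈ C, ∑ j ∈ C, (b j : ℤ) * excCurveDegree π (E j) i ≠ 0 := by
    intro C hCne
    by_contra hall0
    push Not at hall0
    -- (13.1) c): `D'_C` avoids every point of every `E_i`, `i ∈ C`
    have hzero : ∀ i ∈ C, excCurveDegree π (D' C) i = 0 := fun i hi => by
      have h := hrowC C i; rw [hall0 i hi] at h; linarith
    have hall : ∀ i ∈ C, ∀ x ∈ closure ({(i : X)} : Set X), (D' C).Avoids x := fun i hi =>
      ((Lipman1969_13_1_c_holds S X π hπ.isProper hX (D' C) (hD'eff C) i (hη i) (hD'av C i hi)).2).1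
        (hzero i hi)
    -- (A) off `⋃_{i ∈ C} E_i`, avoidance by `D'_C` makes `f` a unit
    have hstepA : ∀ x : X, (D' C).Avoids x → (∀ i : {η // η ∈ F}, i ∈ C → ¬ (i : X) ⤳ x) →
        f ∉ (π.base x).asIdeal := by
      intro x hx hCx hfx
      have h1 : (D' C + N C).Avoids x := hx.add (hNav C x hCx)
      have h2' : (e • P).Avoids x := (hsame C).symm.avoids h1
      have h3 : IsUnitAt x (baseToFunctionField π (f ^ e)) := by
        rw [map_pow]
        exact h2' PUnit.unit trivial
      rw [isUnitAt_baseToFunctionField_iff] at h3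
      exact h3 (Ideal.pow_mem_of_mem _ hfx e he0)
    -- (B) the closed fibre lies inside `⋃_{i ∈ C} E_i`
    obtain ⟨i₀, hi₀⟩ := hCne
    have hFib : ∀ x ∈ π.base ⁻¹' {closedPoint S},
        ∃ i : {η // η ∈ F}, i ∈ C ∧ x ∈ closure ({(i : X)} : Set X) := by
      intro x hx
      by_contra hxC
      push Not at hxC
      have hpre := hπ.isPreconnected_closedFibre
      have hUo : IsOpen ((D' C).nonvanishing 1) := (D' C).isOpen_nonvanishing 1
      set V : Set X := (⋃ i : {η // η ∈ F}, ⋃ (_ : i ∈ C), closure ({(i : X)} : Set X))ᶜ with hVdef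
      have hVo : IsOpen V := (isClosed_biUnion_finset fun i _ => isClosed_closure).isOpen_compl
      have hmemV : ∀ z : X, z ∈ V ↔ ∀ i : {η // η ∈ F}, i ∈ C → z ∉ closure ({(i : X)} : Set X) := by
        intro z; simp [hVdef]
      have hcover : π.base ⁻¹' {closedPoint S} ⊆ (D' C).nonvanishing 1 ∪ V := fun z _ => by
        by_cases hzC : ∃ i : {η // η ∈ F}, i ∈ C ∧ z ∈ closure ({(i : X)} : Set X)
        · obtain ⟨i, hi, hzi⟩ := hzC
          exact Or.inl (CartierDivisor.avoids_iff_mem_nonvanishing_one.1 (hall i hi z hzi))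
        · push Not at hzC
          exact Or.inr ((hmemV z).2 hzC)
      have hUne : (π.base ⁻¹' {closedPoint S} ∩ (D' C).nonvanishing 1).Nonempty :=
        ⟨i₀, (hη i₀).1, CartierDivisor.avoids_iff_mem_nonvanishing_one.1 (hD'av C i₀ hi₀)⟩
      have hVne : (π.base ⁻¹' {closedPoint S} ∩ V).Nonempty := ⟨x, hx, (hmemV x).2 hxC⟩
      obtain ⟨z, hzF, hzU, hzV⟩ := hpre _ _ hUo hVo hcover hUne hVne
      have hzav : (D' C).Avoids z := CartierDivisor.avoids_iff_mem_nonvanishing_one.2 hzU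
      have hCz : ∀ i : {η // η ∈ F}, i ∈ C → ¬ (i : X) ⤳ z := fun i hi h =>
        (hmemV z).1 hzV i hi (specializes_iff_mem_closure.1 h)
      have hfz := hstepA z hzav hCz
      have hzF' : π.base z = closedPoint S := hzF
      rw [hzF'] at hfz
      exact hfz hfm
    -- (C) a prime `𝔭 ∋ f` of height `≤ 1`, hence `≠ 𝔪`
    obtain ⟨p, hp, -⟩ := Ideal.exists_minimalPrimes_le
      (show Ideal.span {f} ≤ maximalIdeal S from (Ideal.span_singleton_le_iff_mem _).2 hfm)
    have hpprime : p.IsPrime := hp.1.1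
    have hfp : f ∈ p := hp.1.2 (Ideal.subset_span (Set.mem_singleton f))
    have hpm : p ≠ maximalIdeal S := by
      intro hpm
      have hh := Ideal.height_le_one_of_isPrincipal_of_mem_minimalPrimes (Ideal.span {f}) p hp
      have hm2 : (maximalIdeal S).height = 2 := by
        have h := IsLocalRing.maximalIdeal_height_eq_ringKrullDim (R := S)
        rw [h2] at h
        exact WithBot.coe_eq_coe.mp (h.trans (WithBot.coe_ofNat 2).symm)
      rw [hpm, hm2] at hh
      exact absurd hh (by decide)
    haveI : IsDominant π := hπ.isBirational.isDominant
    obtain ⟨yp, hyp⟩ := surjective_base_of_isProper π ⟨p, hpprime⟩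
    have hclosed : IsClosed (π.base '' closure ({yp} : Set X)) := π.isClosedMap _ isClosed_closure
    have hmem : closedPoint S ∈ π.base '' closure ({yp} : Set X) :=
      (IsLocalRing.specializes_closedPoint (⟨p, hpprime⟩ : PrimeSpectrum S)).mem_closed hclosed
        ⟨yp, subset_closure (Set.mem_singleton yp), hyp⟩
    obtain ⟨c, hccl, hcm⟩ := hmem
    have hyc : yp ⤳ c := specializes_iff_mem_closure.2 hccl
    obtain ⟨i, hi, hci⟩ := hFib c hcm
    have hD'y : (D' C).Avoids yp := (hall i hi c hci).of_specializes hyc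
    have hCy : ∀ i : {η // η ∈ F}, i ∈ C → ¬ (i : X) ⤳ yp := by
      intro i _ h
      have hym : π.base yp = closedPoint S := base_eq_closedPoint_of_specializes π (hη i).1 h
      rw [hyp] at hym
      exact hpm (congrArg PrimeSpectrum.asIdeal hym)
    have hfy := hstepA yp hD'y hCy
    rw [hyp] at hfy
    exact hfy hfp
  -- the MATRIX HALF
  refine quadForm_neg_of_symm_of_rowSum_nonpos_int (M := fun j i => excCurveDegree π (E j) i)
    (a := fun j => (b j : ℤ)) ?_ ?_ (fun j => by exact_mod_cast hb0 j) ?_ ?_ hy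
  · -- symmetry
    intro i j
    by_cases hij : i = j
    · rw [hij]
    · exact (hcomm i j fun h => hij (Subtype.ext h)).symm
  · -- off-diagonal entries are `≥ 0`
    intro i j hij
    exact excCurveDegree_nonneg_of_isEffective π (hη j) (hEeff i)
      (hEav i j (hnsp (i : X) j (hco i) (hco j) fun h => hij (Subtype.ext h)))
  · -- row sums `≤ 0`
    intro i
    rw [hrowC Finset.univ i, neg_nonpos]
    exact excCurveDegree_nonneg_of_isEffective π (hη i) (hD'eff _) (hD'av _ i (Finset.mem_univ i))
  · exact hstrict

end Summit.ResolutionOfSingularities.ResolutionOfSingularities.Theorems.NoZeno.ExcCount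

end
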